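import Literature.RingTheory.MvPowerSeries.WeierstrassDivision
import Mathlib.RingTheory.MvPowerSeries.Rename
import Mathlib.RingTheory.LocalRing.Basic
import Mathlib.RingTheory.LocalRing.MaximalIdeal.Basic
import Mathlib.Algebra.MvPolynomial.Funext
import Mathlib.Data.Finsupp.Option
import HarnessLib

/-!
# Convergent power series: renaming variables, locality, and generic regularity

Topic `Literature/RingTheory/MvPowerSeries`.  Bookkeeping for the rings `𝕜{x}` of convergent
power series (`ConvergentPowerSeries.lean`) used by the Rückert basis theorem and by the
Denef–van den Dries elimination:

* **Renaming variables along an injection** preserves the weighted norms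
  (`wnorm_rename_embedding`) and convergence (`HasPosRadius.rename_embedding`); along an
  equivalence we get the algebra isomorphism `convergentCongr e : convergent σ 𝕜 ≃ₐ convergent τ 𝕜`,
  and along `Option.some` the embedding `convergentOptionEmb : convergent σ 𝕜 →ₐ convergent (Option σ) 𝕜`.
* **`𝕜{x}` is a local ring** (`convergent.isLocalRing`), with maximal ideal the series vanishing
  at `0` (`mem_maximalIdeal_iff`).
* **Shear coordinate changes** `x'ᵢ ↦ x'ᵢ + cᵢ T` (`shear c`) are algebra automorphisms of
  `𝕜⟦T, x'⟧` preserving convergence, and their pure-`T` part is computed by the reduction `redT`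
  (`coeff_single_none_shear`).
* **Generic regularity** (Grauert–Remmert, Kap. I §4, Hilfssatz to Satz 3; Ruiz 1993, Lemma 2.2):
  for a non-zero convergent `g` in finitely many variables over an infinite field there is a
  shear `c` with `shear c g` regular in `T` of order `ord g` (`exists_shear_isTRegular`).

Everything is proved; no named facts.

## References

* H. Grauert, R. Remmert, *Analytische Stellenalgebren*, Springer (1971), Kap. I §4.
  [GrauertRemmert1971]
* J. M. Ruiz, *The basic theory of power series*, Vieweg (1993), §2. [Ruiz1993]
* J. Denef, L. van den Dries, *p-adic and real subanalytic sets*, Ann. of Math. 128 (1988), §4.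
  [DenefvandenDries1988]
-/

noncomputable section

open MvPowerSeries Finsupp Filter Function
open scoped NNReal ENNReal Topology BigOperators

namespace Literature.RingTheory.MvPowerSeries

variable {σ τ : Type*} {𝕜 : Type*} [NormedField 𝕜]

/-! ### 1. Renaming variables -/

section Rename

/-- Weights transform under an injective renaming: `(ρ)^{ψ_* y} = (ρ ∘ ψ)^y`. [folklore] -/
theorem wt_mapDomain {ψ : σ → τ} (hψ : Injective ψ) (ρ : τ → ℝ≥0) (y : σ →₀ ℕ) :
    wt ρ (mapDomain ψ y) = wt (ρ ∘ ψ) y := by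
  unfold wt
  exact Finsupp.prod_mapDomain_index_inj hψ

/-- **Renaming along an injection preserves the weighted norms**:
`‖rename ψ f‖_ρ = ‖f‖_{ρ ∘ ψ}`. [folklore] -/
theorem wnorm_rename_embedding (ψ : σ ↪ τ) (ρ : τ → ℝ≥0) (f : MvPowerSeries σ 𝕜) :
    wnorm ρ (rename ψ f) = wnorm (ρ ∘ ψ) f := by
  unfold wnorm
  have hinj : Injective (Finsupp.mapDomain (ψ : σ → τ) : (σ →₀ ℕ) → (τ →₀ ℕ)) :=
    Finsupp.mapDomain_injective ψ.injective
  rw [← hinj.tsum_eq]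
  · refine tsum_congr fun y => ?_
    rw [← Finsupp.embDomain_eq_mapDomain, coeff_embDomain_rename, Finsupp.embDomain_eq_mapDomain,
      wt_mapDomain ψ.injective]
  · intro x hx
    by_contra hx'
    apply hx
    change ((‖coeff x (rename ψ f)‖₊ * wt ρ x : ℝ≥0) : ℝ≥0∞) = 0
    rw [coeff_rename_eq_zero (ψ : σ → τ) f hx']; simp

/-- Renaming along an injection preserves convergence. [folklore] -/
theorem HasPosRadius.rename_embedding (ψ : σ ↪ τ) {f : MvPowerSeries σ 𝕜} (hf : HasPosRadius f) :
    HasPosRadius (rename ψ f) := by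
  obtain ⟨ρ, hρ, hfin⟩ := hf
  refine ⟨Function.extend ψ ρ 1, fun t => ?_, ?_⟩
  · by_cases ht : ∃ s, ψ s = t
    · obtain ⟨s, rfl⟩ := ht
      rw [ψ.injective.extend_apply]; exact hρ s
    · rw [Function.extend_apply' _ _ _ ht]; exact one_pos
  · rw [wnorm_rename_embedding]
    have : (Function.extend ψ ρ 1) ∘ ψ = ρ := funext fun s => ψ.injective.extend_apply _ _ _
    rw [this]; exact hfin

/-- Renaming along an equivalence preserves convergence (iff). [folklore] -/
theorem hasPosRadius_rename_equiv_iff (e : σ ≃ τ) (f : MvPowerSeries σ 𝕜) :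
    HasPosRadius (rename e f) ↔ HasPosRadius f := by
  constructor
  · intro h
    have h1 := HasPosRadius.rename_embedding e.symm.toEmbedding h
    have h2 : rename (e.symm.toEmbedding : τ → σ) (rename (e : σ → τ) f) = f := by
      change rename e.symm (rename e f) = f
      rw [rename_rename]; simp
    rwa [h2] at h1
  · intro h
    exact HasPosRadius.rename_embedding e.toEmbedding h

variable (𝕜) in
/-- **Renaming the variables of convergent power series along an equivalence**: the algebra
isomorphism `convergent σ 𝕜 ≃ₐ[𝕜] convergent τ 𝕜`. [folklore] -/
def convergentCongr (e : σ ≃ τ) : convergent σ 𝕜 ≃ₐ[𝕜] convergent τ 𝕜 :=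
  ((renameEquiv 𝕜 e).subalgebraMap (convergent σ 𝕜)).trans
    (Subalgebra.equivOfEq _ _ (by
      ext f
      simp only [Subalgebra.mem_map]
      constructor
      · rintro ⟨g, hg, rfl⟩
        exact (hasPosRadius_rename_equiv_iff e g).mpr hg
      · intro hf
        refine ⟨renameEquiv 𝕜 e.symm f, ?_, ?_⟩
        · exact (hasPosRadius_rename_equiv_iff e.symm f).mpr hf
        · change rename e (rename e.symm f) = f
          rw [rename_rename]; simp))

/-- `convergentCongr` acts by `rename`. [folklore] -/
@[simp] theorem coe_convergentCongr (e : σ ≃ τ) (f : convergent σ 𝕜) :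
    ((convergentCongr 𝕜 e f : convergent τ 𝕜) : MvPowerSeries τ 𝕜) = rename e (f : MvPowerSeries σ 𝕜) :=
  rfl

variable (σ 𝕜) in
/-- **The embedding `𝕜{x'} ↪ 𝕜{T, x'}`** (variables `some i`), as an algebra homomorphism of the
convergent subalgebras. [folklore] -/
def convergentOptionEmb : convergent σ 𝕜 →ₐ[𝕜] convergent (Option σ) 𝕜 :=
  ((rename (Function.Embedding.some : σ ↪ Option σ)).comp (convergent σ 𝕜).val).codRestrict
    (convergent (Option σ) 𝕜) fun f => HasPosRadius.rename_embedding _ f.2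

/-- `convergentOptionEmb` acts by `rename some`. [folklore] -/
@[simp] theorem coe_convergentOptionEmb (f : convergent σ 𝕜) :
    ((convergentOptionEmb σ 𝕜 f : convergent (Option σ) 𝕜) : MvPowerSeries (Option σ) 𝕜) =
      rename (Function.Embedding.some : σ ↪ Option σ) (f : MvPowerSeries σ 𝕜) :=
  rfl

/-- Coefficients of `rename some f`: `[x^e] = [x'^{e.some}] f` if `e none = 0`, else `0`.
[folklore] -/
theorem coeff_rename_some (f : MvPowerSeries σ 𝕜) (e : Option σ →₀ ℕ) :
    coeff e (rename (Function.Embedding.some : σ ↪ Option σ) f) =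
      if e none = 0 then coeff e.some f else 0 := by
  by_cases he : e none = 0
  · rw [if_pos he]
    have : e = Finsupp.embDomain (Function.Embedding.some : σ ↪ Option σ) e.some := by
      rw [Finsupp.embDomain_eq_mapDomain]
      ext (_ | s)
      · rw [he, Finsupp.mapDomain_notin_range]; simp
      · change e (Option.some s) = Finsupp.mapDomain Option.some e.some (Option.some s)
        rw [Finsupp.mapDomain_apply (Option.some_injective σ), Finsupp.some_apply]
    conv_lhs => rw [this]
    rw [coeff_embDomain_rename]
  · rw [if_neg he]
    apply coeff_rename_eq_zero
    rintro ⟨y, hy⟩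
    apply he
    rw [← hy, Finsupp.mapDomain_notin_range]
    simp

end Rename

/-! ### 2. `𝕜{x}` is a local ring -/

section Local

/-- **`𝕜{x}` is a local ring.** [cite: GrauertRemmert1971, Kap. I §2] -/
instance convergent.isLocalRing : IsLocalRing (convergent σ 𝕜) := by
  refine IsLocalRing.of_isUnit_or_isUnit_one_sub_self fun f => ?_
  by_cases h : constantCoeff (f : MvPowerSeries σ 𝕜) = 0
  · right
    rw [isUnit_iff_constantCoeff_ne_zero]
    push_cast
    rw [map_sub, map_one, h, sub_zero]; exact one_ne_zero
  · left; rwa [isUnit_iff_constantCoeff_ne_zero]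

/-- The maximal ideal of `𝕜{x}` consists of the series vanishing at `0`.
[cite: GrauertRemmert1971, Kap. I §2] -/
theorem mem_maximalIdeal_iff (f : convergent σ 𝕜) :
    f ∈ IsLocalRing.maximalIdeal (convergent σ 𝕜) ↔ constantCoeff (f : MvPowerSeries σ 𝕜) = 0 := by
  rw [IsLocalRing.mem_maximalIdeal, mem_nonunits_iff, isUnit_iff_constantCoeff_ne_zero, not_not]

/-- Variables lie in the maximal ideal. [folklore] -/
theorem X_mem_maximalIdeal (i : σ) :
    (⟨X i, HasPosRadius.X i⟩ : convergent σ 𝕜) ∈ IsLocalRing.maximalIdeal (convergent σ 𝕜) := by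
  rw [mem_maximalIdeal_iff]; exact constantCoeff_X i

end Local

/-! ### 3. Shear coordinate changes `x'ᵢ ↦ x'ᵢ + cᵢ T` -/

section Shear

/-- The substitution data of the shear `T ↦ T`, `x'ᵢ ↦ x'ᵢ + cᵢ T`. [cite: GrauertRemmert1971, Kap. I §4] -/
def shearFun (c : σ → 𝕜) : Option σ → MvPowerSeries (Option σ) 𝕜 :=
  fun o => Option.elim o (X none) fun i => X (some i) + C (c i) * X none

/-- The shear fixes `T`. [folklore] -/
@[simp] theorem shearFun_none (c : σ → 𝕜) : shearFun c none = (X none : MvPowerSeries (Option σ) 𝕜) := rfl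

/-- The shear moves `x'ᵢ` to `x'ᵢ + cᵢ T`. [folklore] -/
@[simp] theorem shearFun_some (c : σ → 𝕜) (i : σ) :
    shearFun c (some i) = (X (some i) + C (c i) * X none : MvPowerSeries (Option σ) 𝕜) := rfl

/-- The shear data have zero constant coefficients. [folklore] -/
theorem constantCoeff_shearFun (c : σ → 𝕜) (o : Option σ) : constantCoeff (shearFun c o) = 0 := by
  rcases o with _ | i <;> simp

/-- `redT` of a variable `x'ᵢ` vanishes. [folklore] -/
theorem redT_X_some {R : Type*} [CommRing R] (i : σ) :
    redT (X (some i) : MvPowerSeries (Option σ) R) = 0 := by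
  classical
  ext k
  rw [coeff_redT, coeff_X, map_zero, if_neg]
  intro h
  have := congrArg (fun f : Option σ →₀ ℕ => f (some i)) h
  simp at this

/-- `redT` of a constant. [folklore] -/
theorem redT_C {R : Type*} [CommRing R] (r : R) :
    redT (C r : MvPowerSeries (Option σ) R) = PowerSeries.C r := by
  classical
  ext k
  rw [coeff_redT, coeff_C, PowerSeries.coeff_C]
  simp only [Finsupp.single_eq_zero]

/-- Coefficients below the order vanish; `ord` packaged as the least degree carrying a non-zero
coefficient of a non-zero series (via `Nat.find`). [folklore] -/
theorem exists_least_degree {g : MvPowerSeries (Option σ) 𝕜} (hg : g ≠ 0) :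
    ∃ m₀ : ℕ, (∃ α : Option σ →₀ ℕ, α.degree = m₀ ∧ coeff α g ≠ 0) ∧
      ∀ α : Option σ →₀ ℕ, α.degree < m₀ → coeff α g = 0 := by
  classical
  have hex : ∃ m, ∃ α : Option σ →₀ ℕ, α.degree = m ∧ coeff α g ≠ 0 := by
    by_contra h
    push Not at h
    exact hg (MvPowerSeries.ext fun α => by simpa using h _ α rfl)
  refine ⟨Nat.find hex, Nat.find_spec hex, fun α hα => ?_⟩
  by_contra h
  exact Nat.find_min hex hα ⟨α, rfl, h⟩

variable [Finite σ]

/-- The shear data can be substituted. [folklore] -/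
theorem hasSubst_shearFun (c : σ → 𝕜) : HasSubst (shearFun c) :=
  hasSubst_of_constantCoeff_zero (constantCoeff_shearFun c)

/-- **The shear automorphism** `g(T, x') ↦ g(T, x' + c T)`. [cite: GrauertRemmert1971, Kap. I §4] -/
def shear (c : σ → 𝕜) (g : MvPowerSeries (Option σ) 𝕜) : MvPowerSeries (Option σ) 𝕜 :=
  subst (shearFun c) g

/-- `shear c` is the algebra homomorphism `substAlgHom`. [folklore] -/
theorem shear_eq_substAlgHom (c : σ → 𝕜) (g : MvPowerSeries (Option σ) 𝕜) :
    shear c g = substAlgHom (hasSubst_shearFun c) g := by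
  rw [shear, ← substAlgHom_apply (hasSubst_shearFun c)]

/-- Shears compose additively: `shear c (shear c' g) = shear (c' + c) g`. [folklore] -/
theorem shear_shear (c c' : σ → 𝕜) (g : MvPowerSeries (Option σ) 𝕜) :
    shear c (shear c' g) = shear (c' + c) g := by
  unfold shear
  rw [subst_comp_subst_apply (hasSubst_shearFun c') (hasSubst_shearFun c)]
  congr 1
  funext o
  rcases o with _ | i
  · simp only [shearFun_none]; rw [subst_X (hasSubst_shearFun c)]; rfl
  · simp only [shearFun_some, Pi.add_apply]
    rw [subst_add (hasSubst_shearFun c), subst_X (hasSubst_shearFun c), subst_mul (hasSubst_shearFun c),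
      subst_C, subst_X (hasSubst_shearFun c), shearFun_some, shearFun_none, map_add]
    ring

omit [Finite σ] in
/-- The trivial shear is the identity. [folklore] -/
theorem shear_zero (g : MvPowerSeries (Option σ) 𝕜) : shear 0 g = g := by
  unfold shear
  have : shearFun (0 : σ → 𝕜) = X := by
    funext o; rcases o with _ | i <;> simp
  rw [this, subst_self]; rfl

/-- Shears are invertible: `shear (-c)` undoes `shear c`. [folklore] -/
theorem shear_neg_shear (c : σ → 𝕜) (g : MvPowerSeries (Option σ) 𝕜) : shear (-c) (shear c g) = g := by
  rw [shear_shear, add_neg_cancel, shear_zero]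

/-- Shears preserve convergence. [cite: GrauertRemmert1971, Kap. I §4] -/
theorem HasPosRadius.shear (c : σ → 𝕜) {g : MvPowerSeries (Option σ) 𝕜} (hg : HasPosRadius g) :
    HasPosRadius (shear c g) := by
  refine HasPosRadius.subst (constantCoeff_shearFun c) (fun o => ?_) hg (fun _ => 1) fun _ => one_pos
  rcases o with _ | i
  · exact HasPosRadius.X none
  · exact (HasPosRadius.X _).add ((HasPosRadius.C _).mul (HasPosRadius.X _))

/-- Degree splits along `Option`: `|α| = α none + |α.some|` (finite index type). [folklore] -/
theorem degree_eq_none_add_degree_some (α : Option σ →₀ ℕ) : α.degree = α none + α.some.degree := by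
  classical
  haveI := Fintype.ofFinite σ
  rw [Finsupp.degree_eq_sum, Finsupp.degree_eq_sum, Fintype.sum_option]
  rfl

/-- The pure-`T` reduction of a sheared monomial:
`redT ((shearFun c)^α) = c^{α.some} X^{|α|}`. [folklore] -/
theorem redT_finsuppProd_shearFun (c : σ → 𝕜) (α : Option σ →₀ ℕ) :
    redT (α.prod fun o k => shearFun c o ^ k) =
      PowerSeries.C (α.some.prod fun i k => c i ^ k) * PowerSeries.X ^ α.degree := by
  classical
  rw [map_finsuppProd, Finsupp.prod_option_index _ (fun o k => redT (shearFun c o ^ k))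
    (fun o => by simp) (fun o k l => by rw [pow_add, map_mul])]
  simp only [shearFun_none, shearFun_some]
  rw [map_pow, redT_X_none]
  have hsome : (α.some.prod fun i k =>
      redT ((X (some i) + C (c i) * X none : MvPowerSeries (Option σ) 𝕜) ^ k)) =
      α.some.prod fun i k => PowerSeries.C (c i ^ k) * PowerSeries.X ^ k := by
    refine Finsupp.prod_congr fun i _ => ?_
    rw [map_pow, map_add, map_mul, redT_X_some, redT_C, redT_X_none, zero_add, mul_pow, ← map_pow]
  rw [hsome, Finsupp.prod_mul, ← map_finsuppProd, degree_eq_none_add_degree_some, pow_add]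
  have hX : (α.some.prod fun _ k => (PowerSeries.X : PowerSeries 𝕜) ^ k) =
      PowerSeries.X ^ α.some.degree := by
    rw [Finsupp.degree_apply, Finsupp.prod, Finset.prod_pow_eq_pow_sum]
  rw [hX]
  ring

/-- **Pure-`T` coefficients of a sheared series**: `[T^m] (shear c g) = ∑_{|α| = m} g_α c^{α.some}`.
[cite: GrauertRemmert1971, Kap. I §4] -/
theorem coeff_single_none_shear (c : σ → 𝕜) (g : MvPowerSeries (Option σ) 𝕜) (m : ℕ) :
    coeff (single none m) (shear c g) =
      ∑ α ∈ (Finsupp.finite_of_degree_le (σ := Option σ) m).toFinset with α.degree = m,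
        coeff α g * α.some.prod fun i k => c i ^ k := by
  classical
  rw [shear, coeff_subst (hasSubst_shearFun c)]
  have hterm : ∀ α : Option σ →₀ ℕ, coeff α g • coeff (single none m) (α.prod fun o k => shearFun c o ^ k) =
      if α.degree = m then coeff α g * α.some.prod fun i k => c i ^ k else 0 := by
    intro α
    rw [← coeff_redT, redT_finsuppProd_shearFun, PowerSeries.coeff_C_mul, PowerSeries.coeff_X_pow,
      smul_eq_mul]
    by_cases h : α.degree = m
    · rw [if_pos h, if_pos h.symm, mul_one]
    · rw [if_neg h, if_neg (Ne.symm h), mul_zero, mul_zero]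
  simp_rw [hterm]
  rw [finsum_eq_sum_of_support_subset _ (s := ((Finsupp.finite_of_degree_le (σ := Option σ) m).toFinset.filter
      fun α => α.degree = m))]
  · refine Finset.sum_congr rfl fun α hα => ?_
    rw [Finset.mem_filter] at hα
    rw [if_pos hα.2]
  · intro α hα
    rw [Function.mem_support] at hα
    simp only [Finset.coe_filter, Set.Finite.mem_toFinset, Set.mem_setOf_eq]
    by_cases h : α.degree = m
    · exact ⟨h.le, h⟩
    · exact absurd (if_neg h) hα

variable [Infinite 𝕜]

/-- **Generic regularity by a shear** (Grauert–Remmert, Kap. I §4; Ruiz 1993, Lemma 2.2): a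
non-zero power series in finitely many variables over an infinite field becomes regular in `T` of
order equal to its order after a shear `x'ᵢ ↦ x'ᵢ + cᵢ T`. [cite: GrauertRemmert1971, Kap. I §4] -/
theorem exists_shear_isTRegular {g : MvPowerSeries (Option σ) 𝕜} (hg : g ≠ 0) :
    ∃ (c : σ → 𝕜) (d : ℕ), IsTRegular d (shear c g) := by
  classical
  obtain ⟨m₀, ⟨α₀, hα₀, hgα₀⟩, hlow⟩ := exists_least_degree hg
  -- the degree-`m₀` form as a polynomial in `c`
  set S : Finset (Option σ →₀ ℕ) :=
    (Finsupp.finite_of_degree_le (σ := Option σ) m₀).toFinset.filter fun α => α.degree = m₀ with hS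
  set Q : MvPolynomial σ 𝕜 := ∑ α ∈ S, MvPolynomial.monomial α.some (coeff α g) with hQ
  have hmemS : ∀ α : Option σ →₀ ℕ, α ∈ S ↔ α.degree = m₀ := by
    intro α
    simp only [hS, Finset.mem_filter, Set.Finite.mem_toFinset, Set.mem_setOf_eq]
    exact ⟨fun h => h.2, fun h => ⟨h.le, h⟩⟩
  have heval : ∀ c : σ → 𝕜, MvPolynomial.eval c Q = coeff (single none m₀) (shear c g) := by
    intro c
    rw [coeff_single_none_shear, hQ, map_sum]
    refine Finset.sum_congr rfl fun α _ => ?_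
    rw [MvPolynomial.eval_monomial]
  -- `Q ≠ 0`: its coefficient at `α₀.some` is `g_{α₀}`
  have hinj : ∀ α ∈ S, ∀ β ∈ S, α.some = β.some → α = β := by
    intro α hα β hβ h
    have hα' := (hmemS α).mp hα
    have hβ' := (hmemS β).mp hβ
    rw [degree_eq_none_add_degree_some] at hα' hβ'
    have hn : α none = β none := by rw [h] at hα'; omega
    ext (_ | i)
    · exact hn
    · have := DFunLike.congr_fun h i
      simpa using this
  have hQ0 : Q ≠ 0 := by
    intro h0
    have := congrArg (MvPolynomial.coeff α₀.some) h0
    rw [hQ, MvPolynomial.coeff_sum, MvPolynomial.coeff_zero,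
      Finset.sum_eq_single α₀] at this
    · rw [MvPolynomial.coeff_monomial, if_pos rfl] at this
      exact hgα₀ this
    · intro β hβ hne
      rw [MvPolynomial.coeff_monomial, if_neg]
      intro h
      exact hne (hinj β hβ α₀ ((hmemS α₀).mpr hα₀) h)
    · intro h; exact absurd ((hmemS α₀).mpr hα₀) h
  -- choose `c` with `Q(c) ≠ 0`
  obtain ⟨c, hc⟩ : ∃ c : σ → 𝕜, MvPolynomial.eval c Q ≠ 0 := by
    by_contra h
    push Not at h
    exact hQ0 (MvPolynomial.funext fun c => by rw [h c, map_zero])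
  refine ⟨c, m₀, fun k hk => ?_, ?_⟩
  · rw [coeff_single_none_shear]
    refine Finset.sum_eq_zero fun α hα => ?_
    rw [Finset.mem_filter] at hα
    rw [hlow α (hα.2 ▸ hk), zero_mul]
  · rw [← heval c]; exact hc

end Shear

end Literature.RingTheory.MvPowerSeries
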